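import Literature.NumberTheory.ZetaValues.CohenRivoalKernelBounds
import Literature.NumberTheory.ZetaValues.WZSummation
import HarnessLib

/-!
# The Cohen–Rivoal bivariate Apéry-like identity (proof of the named fact `rivoal2004_theorem11`)

Topic `Literature/NumberTheory/ZetaValues`; proofs-only companion of `AperyLikeGeneratingFunctions.lean`, discharging
`rivoal2004_theorem11` [Rivoal2004, Thm 1.1; Bradley 2008; HessamiPilehrood2008MarkovWZ, Thm 2]: for complex `a, b` with
`|a|² + |b|⁴ < 1`,
`Σ_{n≥1} n/(n⁴ − a²n² − b⁴) = ½ Σ_{k≥1} ((−1)^{k+1}/C(2k,k)) (1/k) (5k²−a²)/(k⁴−a²k²−b⁴) ∏_{m<k} R(m)/P(m)`,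
`P(m) = m⁴ − a²m² − b⁴`, `R(m) = (m²−a²)² + 4b⁴`.
With it the file's PROVED corollaries `koecher_of_theorem11` (Koecher's generating function (1–2)) and
`almkvistGranville_of_theorem11` (Almkvist–Granville's (1–3)) become unconditional.

Proof: the Markov–WZ pair `(F, G)` of `CohenRivoalMarkovWZPair.lean` (`cohenRivoal_wz`, `cohenRivoal_F_zero`,
`cohenRivoal_G_zero`) is summed by `wz_tsum_eq_tsum` (`WZSummation.lean`); `Σ_k F(0,k) = Σ_n G(n,0)` IS the identity.
Its four analytic hypotheses follow from the kernel majorants of `CohenRivoalKernelBounds.lean`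
(`‖κ_n‖‖H(n,k)‖ ≤ K·c(n,k)`, `K = 2e¹⁴/(1−ρ)`, `c(n,k) = n!⁶k!⁴/(2(2n+1)!((n+k+1)!)⁴)`) exactly as in
`AlmkvistGranvilleZetaSevenProofs.lean`: `‖F(n,k)‖ ≤ K/((n+1)³(k+1)²)`, `‖G(n,k)‖ ≤ (5K/2)/((n+1)²(k+1)²)`.
All helpers are private; the only public declaration is `rivoal2004_theorem11_holds`.
-/

open Finset Filter Topology

noncomputable section

namespace Literature.NumberTheory.ZetaValues

/-- `(n+1)!(k+1)! ≤ (n+k+1)!`. [folklore] -/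
private theorem factorial_succ_mul_factorial_succ_le' (n k : ℕ) :
    (n + 1).factorial * (k + 1).factorial ≤ (n + k + 1).factorial := by
  induction n with
  | zero => simp
  | succ n ih =>
    rw [Nat.factorial_succ (n + 1), show n + 1 + k + 1 = (n + k + 1) + 1 by ring, Nat.factorial_succ (n + k + 1),
      mul_assoc]
    exact Nat.mul_le_mul (by omega) ih

/-- The real majorant `c(n,k) = n!⁶k!⁴/(2(2n+1)!((n+k+1)!)⁴)` of `|κ_n H(n,k)|`: `0 ≤ c ≤ n!²/(2(2n+1)!(n+1)⁴(k+1)⁴)`,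
`(2n+1) n!² ≤ (2n+1)!`, `n!² ≤ (2n+1)!` (as in `AlmkvistGranvilleZetaSevenProofs.lean`). [folklore] -/
private theorem hyp_bounds' (n k : ℕ) :
    ((n.factorial : ℝ) ^ 6 * (k.factorial : ℝ) ^ 4 /
        (2 * ((2 * n + 1).factorial : ℝ) * ((n + k + 1).factorial : ℝ) ^ 4)) ≤
        (n.factorial : ℝ) ^ 2 / (2 * ((2 * n + 1).factorial : ℝ) * ((n : ℝ) + 1) ^ 4 * ((k : ℝ) + 1) ^ 4) ∧
      (2 * (n : ℝ) + 1) * (n.factorial : ℝ) ^ 2 ≤ ((2 * n + 1).factorial : ℝ) ∧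
      (n.factorial : ℝ) ^ 2 ≤ ((2 * n + 1).factorial : ℝ) := by
  have hsq : (n.factorial : ℝ) ^ 2 ≤ ((2 * n).factorial : ℝ) := by
    have h := Nat.le_of_dvd (Nat.factorial_pos _) (Nat.factorial_mul_factorial_dvd_factorial_add n n)
    rw [sq, two_mul]; exact_mod_cast h
  have h21 : ((2 * n + 1).factorial : ℝ) = (2 * (n : ℝ) + 1) * ((2 * n).factorial : ℝ) := by
    rw [Nat.factorial_succ]; push_cast; ring
  refine ⟨?_, ?_, ?_⟩
  · have h := factorial_succ_mul_factorial_succ_le' n k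
    rw [Nat.factorial_succ, Nat.factorial_succ] at h
    have h' : ((n : ℝ) + 1) * (n.factorial : ℝ) * (((k : ℝ) + 1) * (k.factorial : ℝ)) ≤ ((n + k + 1).factorial : ℝ) := by
      exact_mod_cast h
    have h4 : (((n : ℝ) + 1) * (n.factorial : ℝ) * (((k : ℝ) + 1) * (k.factorial : ℝ))) ^ 4 ≤
        ((n + k + 1).factorial : ℝ) ^ 4 := pow_le_pow_left₀ (by positivity) h' 4
    rw [div_le_div_iff₀ (by positivity) (by positivity)]
    calc (n.factorial : ℝ) ^ 6 * (k.factorial : ℝ) ^ 4 *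
          (2 * ((2 * n + 1).factorial : ℝ) * ((n : ℝ) + 1) ^ 4 * ((k : ℝ) + 1) ^ 4)
        = (n.factorial : ℝ) ^ 2 * (2 * ((2 * n + 1).factorial : ℝ) *
            (((n : ℝ) + 1) * (n.factorial : ℝ) * (((k : ℝ) + 1) * (k.factorial : ℝ))) ^ 4) := by ring
      _ ≤ (n.factorial : ℝ) ^ 2 * (2 * ((2 * n + 1).factorial : ℝ) * ((n + k + 1).factorial : ℝ) ^ 4) := by
          gcongr
  · rw [h21]; nlinarith [(by positivity : (0 : ℝ) ≤ 2 * (n : ℝ) + 1)]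
  · rw [h21]
    nlinarith [(by positivity : (0 : ℝ) ≤ 2 * (n : ℝ) + 1), (by positivity : (0 : ℝ) ≤ ((2 * n).factorial : ℝ))]

/-- The analytic hypotheses of `wz_tsum_eq_tsum` for the Cohen–Rivoal pair: with `K = 2e¹⁴/(1−ρ)`,
`‖F(n,k)‖ ≤ K/((n+1)³(k+1)²)` and `‖G(n,k)‖ ≤ (5K/2)/((n+1)²(k+1)²)`. [folklore] -/
private theorem cohenRivoal_pair_facts {a b : ℂ} (hab : ‖a‖ ^ 2 + ‖b‖ ^ 4 < 1) :
    let F : ℕ → ℕ → ℂ := fun n k =>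
      ((-1 : ℂ) ^ n * (n.factorial : ℂ) / 2 ^ (n + 1) *
        ∏ m ∈ range n, ((((m : ℂ) + 1) ^ 2 - a ^ 2) ^ 2 + 4 * b ^ 4) / (2 * ((m : ℂ) + 1) + 1)) *
        ((2 * (n : ℂ) + 1) * ((n : ℂ) + 2 * k + 2)) *
        (∏ i ∈ range (n + 1), (((k : ℂ) + 1 + i) ^ 4 - a ^ 2 * ((k : ℂ) + 1 + i) ^ 2 - b ^ 4))⁻¹
    let G : ℕ → ℕ → ℂ := fun n k =>
      ((-1 : ℂ) ^ n * (n.factorial : ℂ) / 2 ^ (n + 1) *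
        ∏ m ∈ range n, ((((m : ℂ) + 1) ^ 2 - a ^ 2) ^ 2 + 4 * b ^ 4) / (2 * ((m : ℂ) + 1) + 1)) *
        ((5 * ((n : ℂ) + 1) ^ 2 - a ^ 2) / 2 + 3 * ((n : ℂ) + 1) * k + (k : ℂ) ^ 2) *
        (∏ i ∈ range (n + 1), (((k : ℂ) + 1 + i) ^ 4 - a ^ 2 * ((k : ℂ) + 1 + i) ^ 2 - b ^ 4))⁻¹
    (∀ n, Summable (F n)) ∧ (∀ n, Tendsto (G n) atTop (𝓝 0)) ∧
      Tendsto (fun n => ∑' k, F n k) atTop (𝓝 0) ∧ Summable (fun n => G n 0) := by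
  intro F G
  have hρ1 : 0 < 1 - (‖a‖ ^ 2 + ‖b‖ ^ 4) := by linarith
  have ha1 : ‖a‖ ^ 2 ≤ 1 := by nlinarith [pow_nonneg (norm_nonneg b) 4]
  set K : ℝ := Real.exp 14 * (2 / (1 - (‖a‖ ^ 2 + ‖b‖ ^ 4))) with hK
  have hK0 : 0 ≤ K := by positivity
  have hS2 : Summable fun k : ℕ => 1 / ((k : ℝ) + 1) ^ 2 := by
    simpa using (summable_nat_add_iff 1).2 (Real.summable_one_div_nat_pow.2 one_lt_two)
  -- the kernel: `‖κ_n‖ ‖H(n,k)‖ ≤ K · c(n,k)`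
  have hker : ∀ n k : ℕ,
      ‖((-1 : ℂ) ^ n * (n.factorial : ℂ) / 2 ^ (n + 1) *
        ∏ m ∈ range n, ((((m : ℂ) + 1) ^ 2 - a ^ 2) ^ 2 + 4 * b ^ 4) / (2 * ((m : ℂ) + 1) + 1))‖ *
        ‖(∏ i ∈ range (n + 1), (((k : ℂ) + 1 + i) ^ 4 - a ^ 2 * ((k : ℂ) + 1 + i) ^ 2 - b ^ 4))⁻¹‖ ≤
        K * ((n.factorial : ℝ) ^ 6 * (k.factorial : ℝ) ^ 4 /
            (2 * ((2 * n + 1).factorial : ℝ) * ((n + k + 1).factorial : ℝ) ^ 4)) := by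
    intro n k
    calc ‖((-1 : ℂ) ^ n * (n.factorial : ℂ) / 2 ^ (n + 1) *
        ∏ m ∈ range n, ((((m : ℂ) + 1) ^ 2 - a ^ 2) ^ 2 + 4 * b ^ 4) / (2 * ((m : ℂ) + 1) + 1))‖ *
        ‖(∏ i ∈ range (n + 1), (((k : ℂ) + 1 + i) ^ 4 - a ^ 2 * ((k : ℂ) + 1 + i) ^ 2 - b ^ 4))⁻¹‖
        ≤ (Real.exp 14 * ((n.factorial : ℝ) ^ 6 / (2 * ((2 * n + 1).factorial : ℝ)))) *
            (2 / (1 - (‖a‖ ^ 2 + ‖b‖ ^ 4)) * ((k.factorial : ℝ) / ((n + k + 1).factorial : ℝ)) ^ 4) :=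
          mul_le_mul (cohenRivoal_norm_kappa_le hab n) (cohenRivoal_norm_hprod_inv_le hab n k) (norm_nonneg _) (by positivity)
      _ = K * ((n.factorial : ℝ) ^ 6 * (k.factorial : ℝ) ^ 4 /
            (2 * ((2 * n + 1).factorial : ℝ) * ((n + k + 1).factorial : ℝ) ^ 4)) := by
          rw [hK, div_pow]; ring
  -- the bound on `F`
  have hFb : ∀ n k : ℕ, ‖F n k‖ ≤ K * (1 / ((n : ℝ) + 1) ^ 3) * (1 / ((k : ℝ) + 1) ^ 2) := by
    intro n k
    obtain ⟨hcb, h2n, -⟩ := hyp_bounds' n k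
    have hn : (0 : ℝ) ≤ n := n.cast_nonneg
    have hk : (0 : ℝ) ≤ k := k.cast_nonneg
    have epoly : ‖(2 * (n : ℂ) + 1) * ((n : ℂ) + 2 * k + 2)‖ = (2 * (n : ℝ) + 1) * ((n : ℝ) + 2 * k + 2) := by
      rw [show (2 * (n : ℂ) + 1) * ((n : ℂ) + 2 * k + 2) = (((2 * n + 1) * (n + 2 * k + 2) : ℕ) : ℂ) by push_cast; ring,
        Complex.norm_natCast]
      push_cast; ring
    simp only [F]
    rw [norm_mul, norm_mul, epoly, mul_right_comm]
    have hlin : (n : ℝ) + 2 * k + 2 ≤ 2 * ((n : ℝ) + 1) * ((k : ℝ) + 1) := by nlinarith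
    have hf2 : (n.factorial : ℝ) ^ 2 ≤ ((2 * n + 1).factorial : ℝ) / (2 * (n : ℝ) + 1) := by
      rw [le_div_iff₀ (by positivity)]; linarith
    calc ‖((-1 : ℂ) ^ n * (n.factorial : ℂ) / 2 ^ (n + 1) *
        ∏ m ∈ range n, ((((m : ℂ) + 1) ^ 2 - a ^ 2) ^ 2 + 4 * b ^ 4) / (2 * ((m : ℂ) + 1) + 1))‖ *
        ‖(∏ i ∈ range (n + 1), (((k : ℂ) + 1 + i) ^ 4 - a ^ 2 * ((k : ℂ) + 1 + i) ^ 2 - b ^ 4))⁻¹‖ *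
          ((2 * (n : ℝ) + 1) * ((n : ℝ) + 2 * k + 2))
        ≤ K * ((n.factorial : ℝ) ^ 6 * (k.factorial : ℝ) ^ 4 /
            (2 * ((2 * n + 1).factorial : ℝ) * ((n + k + 1).factorial : ℝ) ^ 4)) *
            ((2 * (n : ℝ) + 1) * (2 * ((n : ℝ) + 1) * ((k : ℝ) + 1))) :=
          mul_le_mul (hker n k) (by gcongr) (by positivity) (mul_nonneg hK0 (by positivity))
      _ ≤ K * ((n.factorial : ℝ) ^ 2 / (2 * ((2 * n + 1).factorial : ℝ) * ((n : ℝ) + 1) ^ 4 * ((k : ℝ) + 1) ^ 4)) *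
            ((2 * (n : ℝ) + 1) * (2 * ((n : ℝ) + 1) * ((k : ℝ) + 1))) := by gcongr
      _ ≤ K * ((((2 * n + 1).factorial : ℝ) / (2 * (n : ℝ) + 1)) /
              (2 * ((2 * n + 1).factorial : ℝ) * ((n : ℝ) + 1) ^ 4 * ((k : ℝ) + 1) ^ 4)) *
            ((2 * (n : ℝ) + 1) * (2 * ((n : ℝ) + 1) * ((k : ℝ) + 1))) := by gcongr
      _ = K * (1 / ((n : ℝ) + 1) ^ 3) * (1 / ((k : ℝ) + 1) ^ 3) := by field_simp
      _ ≤ K * (1 / ((n : ℝ) + 1) ^ 3) * (1 / ((k : ℝ) + 1) ^ 2) := by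
          apply mul_le_mul_of_nonneg_left _ (by positivity)
          exact one_div_le_one_div_of_le (by positivity) (pow_le_pow_right₀ (by linarith) (by norm_num))
  -- the bound on `G`
  have hGb : ∀ n k : ℕ, ‖G n k‖ ≤ 5 / 2 * K * (1 / ((n : ℝ) + 1) ^ 2) * (1 / ((k : ℝ) + 1) ^ 2) := by
    intro n k
    obtain ⟨hcb, -, hf1⟩ := hyp_bounds' n k
    have hn : (0 : ℝ) ≤ n := n.cast_nonneg
    have hk : (0 : ℝ) ≤ k := k.cast_nonneg
    -- `‖Q‖ ≤ 5 (n+1)² (k+1)²`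
    have hQ : ‖(5 * ((n : ℂ) + 1) ^ 2 - a ^ 2) / 2 + 3 * ((n : ℂ) + 1) * k + (k : ℂ) ^ 2‖ ≤
        5 * ((n : ℝ) + 1) ^ 2 * ((k : ℝ) + 1) ^ 2 := by
      have e : (5 * ((n : ℂ) + 1) ^ 2 - a ^ 2) / 2 + 3 * ((n : ℂ) + 1) * k + (k : ℂ) ^ 2 =
          ((5 * ((n : ℝ) + 1) ^ 2 / 2 + 3 * ((n : ℝ) + 1) * k + (k : ℝ) ^ 2 : ℝ) : ℂ) - a ^ 2 / 2 := by
        push_cast; ring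
      rw [e]
      refine (norm_sub_le _ _).trans ?_
      rw [Complex.norm_real, Real.norm_of_nonneg (by positivity), norm_div, norm_pow, show ‖(2 : ℂ)‖ = 2 by norm_num]
      nlinarith [mul_nonneg hn hk, mul_nonneg (mul_nonneg hn hn) hk, pow_nonneg (norm_nonneg a) 2]
    simp only [G]
    rw [norm_mul, norm_mul, mul_right_comm]
    calc ‖((-1 : ℂ) ^ n * (n.factorial : ℂ) / 2 ^ (n + 1) *
        ∏ m ∈ range n, ((((m : ℂ) + 1) ^ 2 - a ^ 2) ^ 2 + 4 * b ^ 4) / (2 * ((m : ℂ) + 1) + 1))‖ *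
        ‖(∏ i ∈ range (n + 1), (((k : ℂ) + 1 + i) ^ 4 - a ^ 2 * ((k : ℂ) + 1 + i) ^ 2 - b ^ 4))⁻¹‖ *
          ‖(5 * ((n : ℂ) + 1) ^ 2 - a ^ 2) / 2 + 3 * ((n : ℂ) + 1) * k + (k : ℂ) ^ 2‖
        ≤ K * ((n.factorial : ℝ) ^ 6 * (k.factorial : ℝ) ^ 4 /
            (2 * ((2 * n + 1).factorial : ℝ) * ((n + k + 1).factorial : ℝ) ^ 4)) *
            (5 * ((n : ℝ) + 1) ^ 2 * ((k : ℝ) + 1) ^ 2) :=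
          mul_le_mul (hker n k) hQ (norm_nonneg _) (mul_nonneg hK0 (by positivity))
      _ ≤ K * ((n.factorial : ℝ) ^ 2 / (2 * ((2 * n + 1).factorial : ℝ) * ((n : ℝ) + 1) ^ 4 * ((k : ℝ) + 1) ^ 4)) *
            (5 * ((n : ℝ) + 1) ^ 2 * ((k : ℝ) + 1) ^ 2) := by gcongr
      _ ≤ K * (((2 * n + 1).factorial : ℝ) / (2 * ((2 * n + 1).factorial : ℝ) * ((n : ℝ) + 1) ^ 4 * ((k : ℝ) + 1) ^ 4)) *
            (5 * ((n : ℝ) + 1) ^ 2 * ((k : ℝ) + 1) ^ 2) := by gcongr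
      _ = 5 / 2 * K * (1 / ((n : ℝ) + 1) ^ 2) * (1 / ((k : ℝ) + 1) ^ 2) := by field_simp
  refine ⟨fun n => Summable.of_norm_bounded (hS2.mul_left _) (hFb n), fun n => ?_, ?_, ?_⟩
  · refine squeeze_zero_norm (hGb n) ?_
    have h := (hS2.tendsto_atTop_zero).const_mul (5 / 2 * K * (1 / ((n : ℝ) + 1) ^ 2))
    rw [mul_zero] at h
    exact h
  · have hle : ∀ n : ℕ, ‖∑' k, F n k‖ ≤ K * (1 / ((n : ℝ) + 1) ^ 3) * ∑' k : ℕ, 1 / ((k : ℝ) + 1) ^ 2 :=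
      fun n => tsum_of_norm_bounded (hS2.hasSum.mul_left _) (hFb n)
    refine squeeze_zero_norm hle ?_
    have h3 : Tendsto (fun n : ℕ => 1 / ((n : ℝ) + 1) ^ 3) atTop (𝓝 0) :=
      tendsto_const_nhds.div_atTop ((tendsto_pow_atTop (by norm_num : (3 : ℕ) ≠ 0)).comp
        (tendsto_atTop_add_const_right _ _ tendsto_natCast_atTop_atTop))
    have h := (h3.const_mul K).mul_const (∑' k : ℕ, 1 / ((k : ℝ) + 1) ^ 2)
    rw [mul_zero, zero_mul] at h
    exact h
  · refine Summable.of_norm_bounded (hS2.mul_left (5 / 2 * K)) fun n => (hGb n 0).trans (le_of_eq ?_)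
    simp

/-- The core of the proof: both series of [Rivoal2004, Thm 1.1] are summable and the identity holds. [folklore] -/
private theorem cohenRivoal_main {a b : ℂ} (hab : ‖a‖ ^ 2 + ‖b‖ ^ 4 < 1) :
    Summable (fun n : ℕ => ((n + 1 : ℕ) : ℂ) / (((n + 1 : ℕ) : ℂ) ^ 4 - a ^ 2 * ((n + 1 : ℕ) : ℂ) ^ 2 - b ^ 4)) ∧
      Summable (fun k : ℕ => rivoalTerm a b (k + 1)) ∧
      ∑' n : ℕ, ((n + 1 : ℕ) : ℂ) / (((n + 1 : ℕ) : ℂ) ^ 4 - a ^ 2 * ((n + 1 : ℕ) : ℂ) ^ 2 - b ^ 4) =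
        (1 / 2 : ℂ) * ∑' k : ℕ, rivoalTerm a b (k + 1) := by
  have hP := cohenRivoal_P_ne_zero hab
  set F : ℕ → ℕ → ℂ := fun n k =>
      ((-1 : ℂ) ^ n * (n.factorial : ℂ) / 2 ^ (n + 1) *
        ∏ m ∈ range n, ((((m : ℂ) + 1) ^ 2 - a ^ 2) ^ 2 + 4 * b ^ 4) / (2 * ((m : ℂ) + 1) + 1)) *
        ((2 * (n : ℂ) + 1) * ((n : ℂ) + 2 * k + 2)) *
        (∏ i ∈ range (n + 1), (((k : ℂ) + 1 + i) ^ 4 - a ^ 2 * ((k : ℂ) + 1 + i) ^ 2 - b ^ 4))⁻¹ with hFdef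
  set G : ℕ → ℕ → ℂ := fun n k =>
      ((-1 : ℂ) ^ n * (n.factorial : ℂ) / 2 ^ (n + 1) *
        ∏ m ∈ range n, ((((m : ℂ) + 1) ^ 2 - a ^ 2) ^ 2 + 4 * b ^ 4) / (2 * ((m : ℂ) + 1) + 1)) *
        ((5 * ((n : ℂ) + 1) ^ 2 - a ^ 2) / 2 + 3 * ((n : ℂ) + 1) * k + (k : ℂ) ^ 2) *
        (∏ i ∈ range (n + 1), (((k : ℂ) + 1 + i) ^ 4 - a ^ 2 * ((k : ℂ) + 1 + i) ^ 2 - b ^ 4))⁻¹ with hGdef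
  obtain ⟨hFs, hGt, hFt, hG0⟩ : (∀ n, Summable (F n)) ∧ (∀ n, Tendsto (G n) atTop (𝓝 0)) ∧
      Tendsto (fun n => ∑' k, F n k) atTop (𝓝 0) ∧ Summable (fun n => G n 0) := cohenRivoal_pair_facts hab
  have hWZ : ∀ n k, F (n + 1) k - F n k = G n (k + 1) - G n k := fun n k => cohenRivoal_wz hP n k
  have key : ∑' k, F 0 k = ∑' n, G n 0 := wz_tsum_eq_tsum hWZ hFs hGt hFt hG0
  have eF : ∀ k : ℕ, F 0 k = ((k : ℂ) + 1) / (((k : ℂ) + 1) ^ 4 - a ^ 2 * ((k : ℂ) + 1) ^ 2 - b ^ 4) :=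
    fun k => cohenRivoal_F_zero a b k
  have eG : ∀ n : ℕ, G n 0 = 1 / 2 * rivoalTerm a b (n + 1) := fun n => cohenRivoal_G_zero a b hP n
  have eF' : ∀ k : ℕ, ((k + 1 : ℕ) : ℂ) / (((k + 1 : ℕ) : ℂ) ^ 4 - a ^ 2 * ((k + 1 : ℕ) : ℂ) ^ 2 - b ^ 4) = F 0 k :=
    fun k => by rw [eF]; push_cast; ring
  refine ⟨(hFs 0).congr fun k => (eF' k).symm, (hG0.mul_left 2).congr fun n => ?_, ?_⟩
  · rw [eG]; ring
  rw [← tsum_mul_left]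
  exact (tsum_congr eF').trans (key.trans (tsum_congr eG))

/-- Both sides of [Rivoal2004, Thm 1.1] converge for `|a|² + |b|⁴ < 1`: the terms `n/(n⁴ − a²n² − b⁴)`, `n ≥ 1`,
are summable (indeed `|n⁴ − a²n² − b⁴| ≥ n²(n² − |a|² − |b|⁴) > 0`, `cohenRivoal_norm_P_ge`).
[cite: Rivoal2004, Theorem 1.1 p. 504 (hypothesis |a|²+|b|⁴<1)] -/
theorem cohenRivoal_summable_lhs {a b : ℂ} (hab : ‖a‖ ^ 2 + ‖b‖ ^ 4 < 1) :
    Summable fun n : ℕ => ((n + 1 : ℕ) : ℂ) / (((n + 1 : ℕ) : ℂ) ^ 4 - a ^ 2 * ((n + 1 : ℕ) : ℂ) ^ 2 - b ^ 4) :=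
  (cohenRivoal_main hab).1

/-- Both sides of [Rivoal2004, Thm 1.1] converge for `|a|² + |b|⁴ < 1`: the general term `rivoalTerm a b k`, `k ≥ 1`,
of the right-hand side is summable. [cite: Rivoal2004, Theorem 1.1 p. 504 (convergence of (1–4))] -/
theorem cohenRivoal_summable_rivoalTerm {a b : ℂ} (hab : ‖a‖ ^ 2 + ‖b‖ ^ 4 < 1) :
    Summable fun k : ℕ => rivoalTerm a b (k + 1) :=
  (cohenRivoal_main hab).2.1

/-- **Rivoal 2004, Theorem 1.1 — the Cohen–Rivoal bivariate Apéry-like identity** (discharge of the named fact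
`rivoal2004_theorem11`): for complex `a, b` with `|a|² + |b|⁴ < 1`,
`Σ_{n≥1} n/(n⁴ − a²n² − b⁴) = ½ Σ_{k≥1} ((−1)^{k+1}/C(2k,k))(1/k)(5k²−a²)/(k⁴−a²k²−b⁴) ∏_{m<k} R(m)/P(m)`
(`P(m) = m⁴ − a²m² − b⁴`, `R(m) = (m²−a²)²+4b⁴`), both series summable (`cohenRivoal_summable_lhs`,
`cohenRivoal_summable_rivoalTerm`), by the Markov–WZ pair of Hessami Pilehrood and WZ summation with vanishing
boundary terms. [cite: Rivoal2004, Theorem 1.1 (1–4) p. 504] [cite: HessamiPilehrood2008MarkovWZ, Theorems 1–2 and §§2–3]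
[cite: Tauraso2020, (1)] -/
theorem rivoal2004_theorem11_holds : rivoal2004_theorem11 := fun _ _ hab => (cohenRivoal_main hab).2.2

end Literature.NumberTheory.ZetaValues
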